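import Mathlib
import HarnessLib
import HarnessLib.Audit
import Summits.ValiantsHypothesis.Statement
import Literature.Computability.AlgebraicComplexity.DeterminantalComplexity
import HarnessLib.Audit.Status.Attr

/-!
Route: ScaledPencil

DORMANT since 2026-08-29T19:43:06Z (census g0: costume|duplicate of route-ValiantsHypothesis-DetQP; reader census-reader-27-g0) — unstaffed, not closed; items shared with open routes are served there. `ledger route dormant <id> --off` reactivates.

# Route ScaledPencil — Kempf–Ness normal form — no operator-scaled θ-stable pencil of
quasi-polynomial size computes per_n

It suffices to show X = ScaledPencilNoQP: for every c and all large n, no NORMAL-FORM affine pencil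
(Λ, (L_ij)) of size
m ≤ 2^((log₂ n + c)^c) has det(Λ + Σ_ij x_ij L_ij) = per_n, where normal form means (b)
OPERATOR-SCALED Λ Λᴴ + Σ L_ij L_ijᴴ = α·I =
Λᴴ Λ + Σ L_ijᴴ L_ij, (c) TORUS-BALANCED Σ_j ‖L_ij‖_F² = α for every i and Σ_i ‖L_ij‖_F² = α for
every j (one constant α > 0), and
(a) θ-STABLE: every proper non-zero subspace U ⊂ ℂ^m strictly expands, dim(ΛU + Σ_ij L_ij U) > dim
U. The crux NormalForm (closed
orbits of the reductive group 𝒢 = S(GL_m × GL_m × T_n × T_n) inside the closed fibre {det = per_n},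
plus Jordan–Hölder at minimal size)
makes (a)–(c) a cost-free WLOG for determinantal expressions of per_n, so X is equivalent to DetQP's
thesis dc(per_n) ≠ 2^(polylog n)
(item DcPerNotQP = stmt-ValiantsHypothesis-0315) but hands every prover the identities ‖Λ‖_F² = (m −
n)α, Σ‖L_ij‖_F² = nα and the expansion
property. Realises card kempf-ness-scaled-pencils (spine; its "simple Kronecker module" corrected to
θ-stable per the novelty audit).
Lean: `∀ c : ℕ, ∃ n₀ : ℕ, ∀ n ≥ n₀, ∀ (m : ℕ) (Λ : Matrix (Fin m) (Fin m) ℂ) (L : Fin n × Fin n →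
Matrix (Fin m) (Fin m) ℂ), (Matrix.of fun a b => MvPolynomial.C (Λ a b) + ∑ v : Fin n × Fin n,
MvPolynomial.C (L v a b) * MvPolynomial.X v).det =
Literature.Computability.AlgebraicComplexity.perPoly (Fin n) ℂ → (∃ α : ℝ, 0 < α ∧ Λ *
Λ.conjTranspose + ∑ v, L v * (L v).conjTranspose = (α : ℂ) • (1 : Matrix (Fin m) (Fin m) ℂ) ∧
Λ.conjTranspose * Λ + ∑ v, (L v).conjTranspose * L v = (α : ℂ) • (1 : Matrix (Fin m) (Fin m) ℂ) ∧ (∀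
i : Fin n, ∑ j : Fin n, ∑ a, ∑ b, ‖L (i, j) a b‖ ^ 2 = α) ∧ (∀ j : Fin n, ∑ i : Fin n, ∑ a, ∑ b, ‖L
(i, j) a b‖ ^ 2 = α)) → (∀ U : Submodule ℂ (Fin m → ℂ), U ≠ ⊥ → U ≠ ⊤ → Module.finrank ℂ U <
Module.finrank ℂ ↥(U.map (Matrix.toLin' Λ) ⊔ ⨆ v, U.map (Matrix.toLin' (L v)))) → 2 ^ ((Nat.log 2 n
+ c) ^ c) < m`

## Assembly
Bookkeeping over PROVED cone facts: NormalForm + ScaledPencilNoQP ⇒ ¬IsQPBounded(dc ∘ per) (NfToDc,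
using `hasDetRepr_determinantalComplexity_holds`);
then `isQPBounded_determinantalComplexity_of_isVPFamily_holds` (VP ⇒ qp-bounded dc, BCS97 Cor
(21.40)) gives ¬IsVPFamily per, and
`mem_VP_ofFintype_iff_holds`, `perFamily_mem_VNP_holds` with
`Summit.ValiantsHypothesis.Hub.valiantsHypothesis_of_not_isVPFamily_per`
(Theorems/HubHub.lean) give VP ℂ ≠ VNP ℂ. No unproved fact is a hypothesis of the assembly.

Rationale: WHY THIS LINE. Mechanism: treat Rep_m(per_n) = {(Λ, L) : det(Λ + Σ x_ij L_ij) = per_n} as a closed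
𝒢-stable affine set that misses 0 and the left-right
null cone (det ≢ 0 ⇒ nc-rank full, DerksenMakam2017, MakamWigderson2021); norm minimisation on an
orbit closure stays in the fibre and its
first-order condition is the moment-map zero of Kempf–Ness (KempfNess1979; King1994 θ-polystability
for the generalised Kronecker quiver;
Gurvits2004 / GargEtAl2019 / doi:10.1109/FOCS.2019.00055 doubly-stochastic operator scaling), which
unpacks to (b)+(c) with ONE α because the
character det P·det Q⁻¹·Πs_i·Πt_j ties the four factors; at minimal size a block-triangular
determinant and the irreducibility of per_n
(vonzurGathen1987 Thm 3.4, in tree `perPoly_irreducible`) force θ-stability (a) with no GIT at all.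
Imported areas: geometric invariant
theory / moment maps and the operator-scaling theory of non-commutative PIT, applied to the FIBRE of
det over a fixed hard polynomial rather
than to orbit closures (GCT) or to symbolic matrices (nc-rank). What it does that DetQP does not:
DetQP's crux DetqpSymmetrization asks that
symmetry be cheap (unproved; false for det in the regular model,
IkenmeyerLandsberg2017/LandsbergRessayre2017); here a weaker structure —
closed-orbit balance + stability — is PROVABLY free, and the lower-bound cruxes are restated over
that rigid class. Negatives index: empty.

RANKED CRUXES. #0 ScaledPencilNoQP (target) — X — for every c there is n₀ such that for n ≥ n₀ every
normal-form pencil (det = per_n, scaled and balanced with one α > 0, θ-stable) has size m > 2^((log₂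
n + c)^c). (why it might fail: Given NormalForm it is equivalent to the extended Valiant hypothesis
VNP ⊄ VQP in dc form (BCS97 (21.41), open, strictly stronger than VH): false if dc(per_n) = n^O(log
n); and the free constraints (a)–(c) may carry no size information at all (they hold for det_n at
size n with α = n).) [BurgisserClausenShokrollahi1997, MignonRessayre2004, Grenet2011,
LandsbergRessayre2017, KempfNess1979]
#2 NormalForm (crux) — NORMAL FORM (card: support theorem, filed first because everything else is
stated over it): if per_n has an affine determinantal representation of size m then for some m' ≤ m
there are Λ ∈ M_{m'}(ℂ), L : [n]² → M_{m'}(ℂ) with det(Λ + Σ x_ij L_ij) = per_n exactly, Λ Λᴴ + Σ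
L_ij L_ijᴴ = α I = Λᴴ Λ + Σ L_ijᴴ L_ij, Σ_j ‖L_ij‖² = α = Σ_i ‖L_ij‖² for all i, j (one α > 0), and
every proper non-zero U has dim(ΛU + Σ L_ij U) > dim U. [difficulty: L] (why it might fail: A paper
theorem (norm minimisation on the closed fibre; first-order condition; Jordan–Hölder at minimal
size), unformalised: no Kempf–Ness/King in Mathlib, the S(GL²×T²) character bookkeeping giving ONE α
is delicate, and stability (not polystability) needs per_n irreducible and an m' < m descent.)
[KempfNess1979, King1994, Gurvits2004, GargEtAl2019, doi:10.1109/FOCS.2019.00055, vonzurGathen1987,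
DerksenMakam2017]
#3 ScaledPencilSuperquadratic (crux) — first rung past Mignon–Ressayre in the normal-form gauge
(card crux A/B): there is ε > 0 such that for all large n every normal-form pencil computing per_n
has size m ≥ n^(2+ε). The gauge supplies ‖Λ‖_F² = (m − n)α, Σ_ij ‖L_ij‖_F² = nα, Λ Λᴴ ≼ αI with det
Λ = 0, and strict expansion of every subspace; the bet is that expansion × degree-n truncation of
det(Λ + L(x)) beats the Hessian-rank ceiling. [deps: NormalForm] [difficulty: open-problem] (why it
might fail: All engines in print saturate at Θ(n²) (MR04 Hessian, LMR13 duals, ABV17; Landsberg 2017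
Rem 6.4.6.5) and norms are degree-blind: AM–GM on a scaled pencil only lower-bounds α, so (b),(c)
alone give nothing past m ≳ n; stability × truncation is the one new input and no such inequality
exists yet.) [MignonRessayre2004, arXiv:1004.4802, AlperBogartVelasco2017, LandsbergGCT2017,
MathesOmladicRadjavi1991, Gurvits2004]
#4 ScaledPencilSuperpolynomial (crux) — polynomial milestone in the gauge (VNP ⊄ VBP strength): for
every c and all large n every normal-form pencil computing per_n has size m > n^c + c. Intended
engines: the quiver count of card crux C (dimension of θ-stable (m,m)-modules of the
(n²+1)-Kronecker quiver whose determinant has x-degree n, against the 𝒢-saturation of Rep_m(per_n))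
and rigidity of the normal-form locus modulo the compact group. [deps: NormalForm] [difficulty:
open-problem] (why it might fail: ABP-derived representations (Grenet, IMM) have a common invariant
flag, so are never θ-stable, yet degenerate INSIDE the fibre to stable points of the same size:
stability alone cannot see width; expected-dimension counts certify emptiness only for generic
targets and per_n is special.) [MalodPortier2008, Burgisser2000, Grenet2011, IkenmeyerLandsberg2017,
King1994, LandsbergRessayre2017]
#9 ScaledSameSize (support) — analytic half of NormalForm, same size: if (Λ, L) of size m computes
per_n then some (Λ', L') of the SAME size m computes per_n and is scaled + balanced with one α > 0
(minimise ‖Λ‖² + Σ‖L_ij‖² over the closure of the 𝒢-orbit, which lies in the closed fibre;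
differentiate along Hermitian one-parameter subgroups; the single character forces equal constants).
[difficulty: provable-now] [KempfNess1979, GargEtAl2019, Gurvits2004]
#9 MinimalRepStable (support) — algebraic half of NormalForm: if per_n has no affine determinantal
representation of size < m, then EVERY pencil (Λ, L) of size m computing per_n is θ-stable (a
subrepresentation (U, W) with dim U = dim W block-triangularises the pencil, det =
det(block₁)·det(block₂), and irreducibility of per_n makes one block a constant, giving a smaller
representation; dim W < dim U would make det ≡ 0). [difficulty: provable-now] [King1994,
vonzurGathen1987, MathesOmladicRadjavi1991]
#9 PencilOfAffine (support) — bookkeeping between `HasDetRepr` (matrices of affine polynomials) and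
pencil data: per_n has an affine determinantal representation of size m iff some (Λ, L) of size m
has det(Λ + Σ x_ij L_ij) = per_n (an entry of total degree ≤ 1 is its constant coefficient plus Σ_v
coeff_v · x_v). [difficulty: provable-now] [MignonRessayre2004, Burgisser2000]
#9 DcPerNotQP (support) — dc(per_n) is not quasi-polynomially bounded — verbatim the target
DetqpThesis of route DetQP (stmt-ValiantsHypothesis-0315), re-asked here so the ledger links the two
decompositions; this route reaches it through NfToDc. [difficulty: open-problem]
[BurgisserClausenShokrollahi1997, MignonRessayre2004, Grenet2011]
#9 NfToDc (support) — glue: NormalForm and ScaledPencilNoQP give DcPerNotQP (if dc(per_n) ≤ 2^((log₂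
n + c)^c) then, dc being attained (`hasDetRepr_determinantalComplexity_holds`), NormalForm yields a
normal-form pencil of size ≤ that bound, contradicting X at c). [difficulty: provable-now]
[Burgisser2000, MignonRessayre2004]

TWO-LAYER PLAN. Foreseen glued splits, none filed now: NormalForm ⇐ ScaledSameSize →
MinimalRepStable → NormalForm (with PencilOfAffine; k = 2);
ScaledPencilSuperquadratic ⇐ GaugeIdentities (‖Λ‖² = (m−n)α, corank Λ ∈ [1, n], Σ L_ijᴴL_ij has top
eigenvalue α on ker Λ) →
ExpansionVsTruncation (a size inequality for θ-stable scaled pencils whose determinant has x-degree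
≤ d) → ScaledPencilSuperquadratic;
ScaledPencilSuperpolynomial ⇐ RigidityAtMinimalSize (finiteness of the normal-form locus modulo K ×
(S_n×S_n ⋊ ℤ/2), n = 3, m = 7 first,
shared with cards grenet-stability-bootstrap / rigidity-implies-grenet if they are routed) →
symmetry inheritance via Kempf–Ness uniqueness.

KILL CRITERIA. NormalForm refuted AS TYPED (a sign/normalisation slip) ⇒ restate within the grace
window, the mathematics is not in doubt; NormalForm refuted
in substance (a minimal-size representation of some per_n with no scaled θ-stable point in its
fibre) ⇒ close refuted:NormalForm. A proof
that dc(per_n) ≤ 2^(polylog n) refutes ScaledPencilNoQP and DcPerNotQP together with route DetQP. A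
theorem "for every polynomial f and every
m ≥ dc(f) the normal-form locus of Rep_m(f) modulo K has the dimension predicted by the naive count"
(no rigidity, no extra identities) makes
the gauge informationless ⇒ close superseded --by route-ValiantsHypothesis-DetQP.
DetqpSuperquadratic proved without the gauge moots crux 3.

NOT DECOMPOSED YET. The analytic engine of the card (capacity / Gaussian second moment E|det(Λ + Σ
g_ij L_ij)|² = n! against scaled tuples; small-ball vs
Tao–Vu anti-concentration) is NOT filed: as computed in NOTES it only lower-bounds α and is blind to
degree, so no true typed inequality is
known; it returns as a layer-2 child of crux 3 once an inequality mixing expansion and truncation is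
found. Also not filed: the base-point
gauge (translate to a with per_n(a) ≠ 0, Λ invertible, K_ij = Λ⁻¹L_ij spanning an n²-dimensional
matrix space with ≤ n non-zero
eigenvalues — IkenmeyerLandsberg2017 trace-power model), uniqueness of the normal form up to K
(Kempf–Ness (b)), von zur Gathen's corank-one
refinement (named fact `vonzurGathen1987_perm_detRepr_rank`, unproved in tree), and any equivariant
version (route DetQP, LR17).

CHEAPEST FALSIFIER. (i) n = 2, 3 by hand/kit: per_2 = det[[x₁₁, −x₁₂],[x₂₁, x₂₂]] is already in
normal form (α = 2); for per_3 run alternating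
left/right/torus Sinkhorn scaling on Grenet's 7 × 7 pencil (dc(per_3) = 7, AlperBogartVelasco2017) —
by MinimalRepStable it must converge
(θ-stable ⇒ closed SL²-orbit); divergence would expose a typing error in (b)/(c) before any prover
starts. (ii) Lookup: does MakamWigderson2021
§11 or the nc-rank literature already record that closed left-right orbits inside a determinantal
fibre impose only (b) and nothing
size-relevant? Searched (see Novelty): no such statement found; remote APIs were rate-limited this
session, so a refuter should re-run it.

NUMBERS. n²/2 ≤ dc(per_n) (MignonRessayre2004 Thm 1.1, in tree
`sq_le_two_mul_determinantalComplexity_perPoly_complex_holds`); dc(per_n) ≤ 2^n − 1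
(Grenet2011, in tree `determinantalComplexity_perPoly_le_holds`); dc(per_3) = 7
(AlperBogartVelasco2017); equivariant edc(per_m) = C(2m,m) − 1
(LandsbergRessayre2017). Gauge identities at a normal-form point: ‖Λ‖_F² = (m − n)α, Σ_ij‖L_ij‖_F² =
nα, 1 ≤ corank Λ ≤ n. Unipotent θ-stable
blocks exist (size 3: I + sJ₃ + tB with B = [[1,0,1],[1,−2,3],[0,−1,1]], det ≡ 1, {J₃, B}
irreducible), so m' < m can occur above minimal
size. Items at open: 10 (1 target, 3 cruxes, 5 support, 1 assembly).

DEFINITION REQUESTS. None needed to type the items (pencil data are plain complex matrices;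
`HasDetRepr`, `perPoly`, `IsQPBounded`, `determinantalComplexity`
exist). Nice-to-have later: `IsThetaStablePencil` / `IsScaledPencil` wrappers in
Summits/ValiantsHypothesis/ValiantsHypothesis/Theorems
to shorten the signatures (a prover may introduce them with `--supports`).

SUPPORT. Route-repair rev 2 (2026-08-15, cone guardrail gen 2; planner
rrepair-ValiantsHypothesis-ScaledPenci-dcd6adba-g2): needs-fact: NONE.
CONE AUDIT (payload list empty; run/shared/views/cone/ValiantsHypothesis.{md,json} absent on this
hub; reconstructed from the import lines,
not regenerated): the route module's project import cone is 8 modules — this file,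
Summits/ValiantsHypothesis/Statement,
Summits/ValiantsHypothesis/ValiantsHypothesis/Statement and
Literature.Computability.AlgebraicComplexity.{ArithCircuit, ValiantClasses,
StandardFamilies, ValiantConjecture, DeterminantalComplexity}. The one planner import,
DeterminantalComplexity, is load-bearing (HasDetRepr in
NormalForm / MinimalRepStable / PencilOfAffine, determinantalComplexity in DcPerNotQP) and all 11 of
its named facts are DISCHARGED in
DeterminantalComplexityProofs.lean (HasDetRepr.mono_holds, exists_hasDetRepr_holds,
hasDetRepr_determinantalComplexity_holds,
hasDetRepr_iff_determinantalComplexity_le_holds, totalDegree_le_of_hasDetRepr_holds,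
totalDegree_le_determinantalComplexity_holds,
HasDetRepr.of_isProjection_holds, IsDetProjection.hasDetRepr_holds,
determinantalComplexity_le_of_isProjection_holds, HasDetRepr.map_holds,
determinantalComplexity_le_detProjectionComplexity_holds) ⇒ 0 imports droppable, 0 cruxes restated.
The undischarged closed Props counted in
the FILE cone all enter through Statement.lean's own imports (ValiantConjecture / ValiantClasses)
and no route edit can remove them:
`VPNeVNPComplex` (@[conjecture]; definitionally the summit `ValiantsHypothesis` =
`Literature.PNP.ValiantHypothesis ℂ` = `VP ℂ ≠ VNP ℂ`) and
`PerNotPComputableComplex` (@[conjecture]; equivalent to it by the PROVED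
`perNotPComputableComplex_iff_holds`, ValiantConjectureEquivProofs.lean)
ARE the target and are never to be discharged as facts — seat nobody on them;
`IsVNPFamily.of_isPProjection` (ValiantClasses.lean, VNP closed
under p-projections among p-families, Burgisser2000 §2.1) is undischarged but used by no item, not
by `closes`, and not by the intended proof
of Assembly. (The four ArithCircuit facts gateValues_append / eval_add / eval_mul / exists_computes
are discharged in
Theorems/StatementJunkGuardArithCircuitExistsComputesProved.lean.) CONSTANT-level cone of the 11
route decls (`#h21_route_deps`, native
preview 2026-08-15T16:36Z, lean rc 0, 0 sorries): 40 project constants, no conjecture leaf, no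
closed cite-only fact — the cited Prop
constants it meets (HasDetRepr, IsAffineDetRepr, IsQPBounded, IsPFamily, IsVPFamily, IsVNPFamily,
IsPComputable, IsPBounded,
ArithCircuit.Computes, ArithCircuit.IsFanInTwo, Literature.PNP.ValiantHypothesis) are predicates
with explicit binders, i.e. definitions —
axioms ⊆ {propext, Classical.choice, Quot.sound}. Deciding theorem slimmed to its load-bearing
hypotheses in the same edit:
`closes : NormalForm → ScaledPencilNoQP → Assembly → ValiantsHypothesis` (audit ok, conclusion
ValiantsHypothesis, extra = []); the other
seven items stay route items (milestone cruxes 3–4, provable-now supports) but are not hypotheses of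
the decision. Assembly (rank 1) is
provable now over PROVED facts only: `hasDetRepr_determinantalComplexity_holds`,
`isQPBounded_determinantalComplexity_of_isVPFamily_holds`
(VPDeterminantalQPProofs.lean, BCS97 Cor. (21.40)), `mem_VP_ofFintype_iff_holds`,
`perFamily_mem_VNP_holds` and
`Summit.ValiantsHypothesis.Hub.valiantsHypothesis_of_not_isVPFamily_per` (Theorems/HubHub.lean).
Serve the route.

Novelty: Searches (2026-08-15): `lit search --hybrid "Kempf-Ness moment map closed orbit matrix tuples
left-right action operator scaling"` (8 book
hits: Kirwan 1984, McDuff–Salamon, Mumford GIT held — generic GIT, nothing on dc); `lit search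
--source crossref` ×5 ("singular tuples of
matrices is not a null cone" → MakamWigderson2021, Bürgin–Draisma 2006; "linear spaces of nilpotent
matrices" → MathesOmladicRadjavi1991;
"operator scaling theory and applications" → GargEtAl2019, AGLOW 2018; "polynomial degree bounds
matrix semi-invariants" → DerksenMakam2017;
King1994); `lit frontier ValiantsHypothesis --since 2021` (30 rows; nearest dc activity
doi:10.1007/s00224-025-10253-8, arXiv:2606.11090,
arXiv:2606.13628 — none uses moment maps); `lit bridges ValiantsHypothesis --cross any` (Wigderson,
Mathematics and Computation
doi:10.2307/j.ctvckq7xb is the only text joining LR17 and operator scaling — expository, no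
application to dc); Landsberg 2017 book grep
(Kempf only via [Kem78] for orbit closures, p. 289); openalex/arXiv/S2 and `lit galaxy` were
rate-limited or saturated this session (card
and novelty-audit searches of 2026-08-15 stand: zbMATH hit MakamWigderson2021 only).
Nearest prior art found: LandsbergRessayre2017 (arXiv:1508.05788: symmetry IMPOSED, exponential edc)
and IkenmeyerLandsberg2017
(arXiv:1610.00159: trace-power / regular models); GargEtAl2019, Gurvits2004,
doi:10.1109/FOCS.2019.00055, DerksenMakam2017 (scaling and
left-right invariant theory for symbolic matrices, PIT  [refs: 10.1007/s00224-025-10253-8, 10.2307/j.ctvckq7xb, 10.1109/FOCS.2019.00055, 2606.11090, 2606.13628, 1508.05788, 1610.00159, doi:10.1007/s00224-025-10253-8, doi:10.2307/j.ctvckq7xb, doi:10.1109/FOCS.2019.00055, MakamWigderson2021, MathesOmladicRadjavi1991, GargEtAl2019, DerksenMakam2017, King1994, LandsbergRessayre2017, IkenmeyerLandsberg2017, Gurvits2004, KempfNess1979]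

Barriers (technique_class: kempf-ness-normal-form, operator-scaling, det-repr): - technique_class: kempf-ness-normal-form, operator-scaling, det-repr
- Literature.Barriers.ValiantsHypothesis.PermanentCharTwo: evaded by construction — (b),(c) are
Hermitian/archimedean conditions over ℂ and the lower-bound cruxes quantify over complex pencils
only; over characteristic 2 the gauge does not exist, consistent with per = det there.
- Literature.Barriers.ValiantsHypothesis.ShiftedPartialsCannotSeparate: not engaged — no flattening
or shifted-partials rank of per_n or of the padded permanent is taken; the objects are the
coefficient matrices of a representation and their subspace expansion. Conceded: escaping the class
is necessary, not sufficient; crux 3 must still beat n²/2 where MR04/LMR13 saturate.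
- Literature.Barriers.ValiantsHypothesis.RankMethods: formally inapplicable (tensor/Waring-rank
certification, not dc); the sub-multiplicativity moral is respected — no rank of a linear image of
per_n is used.
- Literature.Barriers.ValiantsHypothesis.GCTOccurrenceObstructions: not engaged — Kempf–Ness is
applied to the fibre of det over per_n inside M_m(ℂ)^(1+n²), never to the orbit closure of det_m; no
multiplicities or occurrences.
- Literature.Barriers.ValiantsHypothesis.AlgebraicNaturalProofs: conditional barrier
(`SuccinctHittingSetsForVP` ⇒ no algebraic natural proof); a proof of crux 3/4 would certify "per_n
admits no θ-stable scaled pencil of size m", a property of the coefficient vector not known to be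
VP-decidable; it bites only if the final certificate

History (route lifecycle, newest last):
- 2026-08-16T04:21:55Z · AUTO-CRUX (backfill): ScaledPencilNoQP — hypotheses of the deciding theorem that nothing in the route derives are cruxes (operator:999:1085951)
- 2026-08-17T02:13:51Z · rev 4: restated NormalFormOfSubs (stmt-ValiantsHypothesis-17582) — strategist: restate glue item NormalFormOfSubs (stmt-ValiantsHypothesis-17582) with the three proved pieces inlined — the by-name form was rendered BLOCKED (for (planner-cstrat-stmt-ValiantsHypothesis-5317-r1-0)
- 2026-08-24T19:52:12Z · DORMANT — reconciler: no traction for 7 d (last activity item-evidence-added at 2026-08-17T18:43:15Z); parked, not closed — `ledger route dormant route-ValiantsHypothesis (operator:999:3170836)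
- 2026-08-26T05:06:32Z · REACTIVATED — reconciler: reactivated — activity statement-closed at 2026-08-26T04:07:11Z after parking at 2026-08-24T19:52:12Z (operator:999:2120528)
- 2026-08-29T19:43:06Z · DORMANT — census g0: costume|duplicate of route-ValiantsHypothesis-DetQP; reader census-reader-27-g0 (operator:999:1800474)

sub-problem: ValiantsHypothesis · status: dormant · opened planner-plancard-ValiantsHypothesis-ValiantsH-b3f0ecda-0 2026-08-15T11:40:46Z · rev 6 · ledger route-ValiantsHypothesis-ScaledPencil
GENERATED by the gate from the ledger (D-0016/17). Provers cite these decls: `theorem foo : Summit.ValiantsHypothesis.ValiantsHypothesis.Theses.ScaledPencil.<Decl> := …` in Summits/ValiantsHypothesis/ValiantsHypothesis/Theorems/<Name>.lean.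
-/

namespace Summit.ValiantsHypothesis.ValiantsHypothesis.Theses.ScaledPencil

open scoped BigOperators Topology Manifold Classical MeasureTheory ProbabilityTheory Matrix InnerProductSpace ComplexConjugate ContinuousMap
open Filter Set Function TopologicalSpace MeasureTheory

attribute [summit_statement] _root_.ValiantsHypothesis

open Literature.PNP

/-- item stmt-ValiantsHypothesis-5316 · crux (kind.auto-crux: conjecture-grade) · rank 0 · open · by planner
why it might fail: Given NormalForm it is equivalent to the extended Valiant hypothesis VNP ⊄ VQP in dc form (BCS97 (21.41), open, strictly stronger than VH): false if dc(per_n) = n^O(log n); and the free constraints (a)–(c) may carry no size information at all (they hold for det_n at size n with α = n).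
sources: BurgisserClausenShokrollahi1997, MignonRessayre2004, Grenet2011, LandsbergRessayre2017, KempfNess1979
[target] X — for every c there is n₀ such that for n ≥ n₀ every normal-form pencil (det = per_n,
scaled and balanced with one α > 0, θ-stable) has size m > 2^((log₂ n + c)^c). -/
@[route_item "route-ValiantsHypothesis-ScaledPencil", crux]
def ScaledPencilNoQP : Prop :=
  ∀ c : ℕ, ∃ n₀ : ℕ, ∀ n ≥ n₀, ∀ (m : ℕ) (Λ : Matrix (Fin m) (Fin m) ℂ) (L : Fin n × Fin n → Matrix (Fin m) (Fin m) ℂ), (Matrix.of fun a b => MvPolynomial.C (Λ a b) + ∑ v : Fin n × Fin n, MvPolynomial.C (L v a b) * MvPolynomial.X v).det = Literature.Computability.AlgebraicComplexity.perPoly (Fin n) ℂ → (∃ α : ℝ, 0 < α ∧ Λ * Λ.conjTranspose + ∑ v, L v * (L v).conjTranspose = (α : ℂ) • (1 : Matrix (Fin m) (Fin m) ℂ) ∧ Λ.conjTranspose * Λ + ∑ v, (L v).conjTranspose * L v = (α : ℂ) • (1 : Matrix (Fin m) (Fin m) ℂ) ∧ (∀ i : Fin n, ∑ j : Fin n, ∑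 a, ∑ b, ‖L (i, j) a b‖ ^ 2 = α) ∧ (∀ j : Fin n, ∑ i : Fin n, ∑ a, ∑ b, ‖L (i, j) a b‖ ^ 2 = α)) → (∀ U : Submodule ℂ (Fin m → ℂ), U ≠ ⊥ → U ≠ ⊤ → Module.finrank ℂ U < Module.finrank ℂ ↥(U.map (Matrix.toLin' Λ) ⊔ ⨆ v, U.map (Matrix.toLin' (L v)))) → 2 ^ ((Nat.log 2 n + c) ^ c) < m

/-- item stmt-ValiantsHypothesis-5317 · crux · rank 2 · closed · proved by Summit.ValiantsHypothesis.ValiantsHypothesis.Theorems.ScaledPencilNormalFormSplit.normalForm_proof (prover) · by planner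
why it might fail: A paper theorem (norm minimisation on the closed fibre; first-order condition; Jordan–Hölder at minimal size), unformalised: no Kempf–Ness/King in Mathlib, the S(GL²×T²) character bookkeeping giving ONE α is delicate, and stability (not polystability) needs per_n irreducible and an m' < m descent.
sources: KempfNess1979, King1994, Gurvits2004, GargEtAl2019, doi:10.1109/FOCS.2019.00055, vonzurGathen1987
[crux] NORMAL FORM (card: support theorem, filed first because everything else is stated over it):
if per_n has an affine determinantal representation of size m then for some m' ≤ m there are Λ ∈
M_{m'}(ℂ), L : [n]² → M_{m'}(ℂ) with det(Λ + Σ x_ij L_ij) = per_n exactly, Λ Λᴴ + Σ L_ij L_ijᴴ = α I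
= Λᴴ Λ + Σ L_ijᴴ L_ij, Σ_j ‖L_ij‖² = α = Σ_i ‖L_ij‖² for all i, j (one α > 0), and every proper
non-zero U has dim(ΛU + Σ L_ij U) > dim U. [difficulty: L] -/
@[route_item "route-ValiantsHypothesis-ScaledPencil", crux]
def NormalForm : Prop :=
  ∀ (n m : ℕ), Literature.Computability.AlgebraicComplexity.HasDetRepr (Literature.Computability.AlgebraicComplexity.perPoly (Fin n) ℂ) m → ∃ m' ≤ m, ∃ (Λ : Matrix (Fin m') (Fin m') ℂ) (L : Fin n × Fin n → Matrix (Fin m') (Fin m') ℂ), (Matrix.of fun a b => MvPolynomial.C (Λ a b) + ∑ v : Fin n × Fin n, MvPolynomial.C (L v a b) * MvPolynomial.X v).det = Literature.Computability.AlgebraicComplexity.perPoly (Fin n) ℂ ∧ (∃ α : ℝ, 0 < α ∧ Λ * Λ.conjTranspose + ∑ v, L v * (L v).conjTranspose = (α : ℂ) • (1 : Matrix (Fin m') (Fin m') ℂ) ∧ Λ.conjTranspose * Λ + ∑ v, (L v).conjTranspose * L v = (α : ℂ) • (1 : Matrix (Fin m') (Fin m') ℂ) ∧ (∀ i : Fin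 n, ∑ j : Fin n, ∑ a, ∑ b, ‖L (i, j) a b‖ ^ 2 = α) ∧ (∀ j : Fin n, ∑ i : Fin n, ∑ a, ∑ b, ‖L (i, j) a b‖ ^ 2 = α)) ∧ (∀ U : Submodule ℂ (Fin m' → ℂ), U ≠ ⊥ → U ≠ ⊤ → Module.finrank ℂ U < Module.finrank ℂ ↥(U.map (Matrix.toLin' Λ) ⊔ ⨆ v, U.map (Matrix.toLin' (L v))))

-- `NormalForm` holds: proved by `Summit.ValiantsHypothesis.ValiantsHypothesis.Theorems.ScaledPencilNormalFormSplit.normalForm_proof` (its module imports this route file, so no `_holds` link can be stated here).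

/-- item stmt-ValiantsHypothesis-5318 · aside · rank 3 · open · by planner
why it might fail: All engines in print saturate at Θ(n²) (MR04 Hessian, LMR13 duals, ABV17; Landsberg 2017 Rem 6.4.6.5) and norms are degree-blind: AM–GM on a scaled pencil only lower-bounds α, so (b),(c) alone give nothing past m ≳ n; stability × truncation is the one new input and no such inequality exists yet.
sources: MignonRessayre2004, arXiv:1004.4802, AlperBogartVelasco2017, LandsbergGCT2017, MathesOmladicRadjavi1991, Gurvits2004
[crux] first rung past Mignon–Ressayre in the normal-form gauge (card crux A/B): there is ε > 0 such
that for all large n every normal-form pencil computing per_n has size m ≥ n^(2+ε). The gauge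
supplies ‖Λ‖_F² = (m − n)α, Σ_ij ‖L_ij‖_F² = nα, Λ Λᴴ ≼ αI with det Λ = 0, and strict expansion of
every subspace; the bet is that expansion × degree-n truncation of det(Λ + L(x)) beats the
Hessian-rank ceiling. [deps: NormalForm] [difficulty: open-problem] -/
@[route_item "route-ValiantsHypothesis-ScaledPencil"]
def ScaledPencilSuperquadratic : Prop :=
  ∃ ε : ℝ, 0 < ε ∧ ∃ n₀ : ℕ, ∀ n ≥ n₀, ∀ (m : ℕ) (Λ : Matrix (Fin m) (Fin m) ℂ) (L : Fin n × Fin n → Matrix (Fin m) (Fin m) ℂ), (Matrix.of fun a b => MvPolynomial.C (Λ a b) + ∑ v : Fin n × Fin n, MvPolynomial.C (L v a b) * MvPolynomial.X v).det = Literature.Computability.AlgebraicComplexity.perPoly (Fin n) ℂ → (∃ α : ℝ, 0 < α ∧ Λ * Λ.conjTranspose + ∑ v, L v * (L v).conjTranspose = (α : ℂ) • (1 : Matrix (Fin m) (Fin m) ℂ) ∧ Λ.conjTranspose * Λ + ∑ v, (L v).conjTranspose * L v = (α : ℂ) • (1 : Matrix (Fin m) (Fin m) ℂ) ∧ (∀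 i : Fin n, ∑ j : Fin n, ∑ a, ∑ b, ‖L (i, j) a b‖ ^ 2 = α) ∧ (∀ j : Fin n, ∑ i : Fin n, ∑ a, ∑ b, ‖L (i, j) a b‖ ^ 2 = α)) → (∀ U : Submodule ℂ (Fin m → ℂ), U ≠ ⊥ → U ≠ ⊤ → Module.finrank ℂ U < Module.finrank ℂ ↥(U.map (Matrix.toLin' Λ) ⊔ ⨆ v, U.map (Matrix.toLin' (L v)))) → (n : ℝ) ^ (2 + ε) ≤ m

/-- item stmt-ValiantsHypothesis-5319 · aside · rank 4 · open · by planner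
why it might fail: ABP-derived representations (Grenet, IMM) have a common invariant flag, so are never θ-stable, yet degenerate INSIDE the fibre to stable points of the same size: stability alone cannot see width; expected-dimension counts certify emptiness only for generic targets and per_n is special.
sources: MalodPortier2008, Burgisser2000, Grenet2011, IkenmeyerLandsberg2017, King1994, LandsbergRessayre2017
[crux] polynomial milestone in the gauge (VNP ⊄ VBP strength): for every c and all large n every
normal-form pencil computing per_n has size m > n^c + c. Intended engines: the quiver count of card
crux C (dimension of θ-stable (m,m)-modules of the (n²+1)-Kronecker quiver whose determinant has
x-degree n, against the 𝒢-saturation of Rep_m(per_n)) and rigidity of the normal-form locus modulo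
the compact group. [deps: NormalForm] [difficulty: open-problem] -/
@[route_item "route-ValiantsHypothesis-ScaledPencil"]
def ScaledPencilSuperpolynomial : Prop :=
  ∀ c : ℕ, ∃ n₀ : ℕ, ∀ n ≥ n₀, ∀ (m : ℕ) (Λ : Matrix (Fin m) (Fin m) ℂ) (L : Fin n × Fin n → Matrix (Fin m) (Fin m) ℂ), (Matrix.of fun a b => MvPolynomial.C (Λ a b) + ∑ v : Fin n × Fin n, MvPolynomial.C (L v a b) * MvPolynomial.X v).det = Literature.Computability.AlgebraicComplexity.perPoly (Fin n) ℂ → (∃ α : ℝ, 0 < α ∧ Λ * Λ.conjTranspose + ∑ v, L v * (L v).conjTranspose = (α : ℂ) • (1 : Matrix (Fin m) (Fin m) ℂ) ∧ Λ.conjTranspose * Λ + ∑ v, (L v).conjTranspose * L v = (α : ℂ) • (1 : Matrix (Fin m) (Fin m) ℂ) ∧ (∀ i : Fin n, ∑ j : Fin n, ∑ a, ∑ b, ‖L (i, j) a b‖ ^ 2 = α) ∧ (∀ j : Fin n, ∑ i : Fin n, ∑ a, ∑ b, ‖L (i, j) a b‖ ^ 2 = α)) → (∀ U : Submodule ℂ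 (Fin m → ℂ), U ≠ ⊥ → U ≠ ⊤ → Module.finrank ℂ U < Module.finrank ℂ ↥(U.map (Matrix.toLin' Λ) ⊔ ⨆ v, U.map (Matrix.toLin' (L v)))) → n ^ c + c < m

/-- item stmt-ValiantsHypothesis-0315 · support · rank 9 · open · by planner
sources: BurgisserClausenShokrollahi1997, MignonRessayre2004, Grenet2011
Thesis of route DetQP: no c with dc(per_n) <= 2^((log2 n + c)^c) for all n (affine determinantal
complexity, Literature.Computability.AlgebraicComplexity.determinantalComplexity). Strictly stronger
than pnp.S05 (poly form). Sources: MignonRessayre2004, LandsbergRessayre2017, Grenet2011,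
Burgisser2000 §2.5. -/
@[route_item "route-ValiantsHypothesis-ScaledPencil"]
def DcPerNotQP : Prop :=
  ¬ Literature.Computability.AlgebraicComplexity.IsQPBounded (fun n => Literature.Computability.AlgebraicComplexity.determinantalComplexity (Literature.Computability.AlgebraicComplexity.perPoly (Fin n) ℂ))

/-- item stmt-ValiantsHypothesis-0318 · support · rank 9 · open · by planner
Break the Hessian-rank ceiling: known dc(per_n) ≥ n^2/2 [MignonRessayre2004 Thm 1.1; CaiChenLi2010],
dc(per_3)=7 [AlperBogartVelasco2017]; upper bound 2^n-1 [Grenet2011]. Any ε>0 requires a new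
invariant of the determinant hypersurface (higher fundamental forms / singular-locus flattenings).
Most informative crux of the route. -/
@[route_item "route-ValiantsHypothesis-ScaledPencil"]
def DetqpSuperquadratic : Prop :=
  ∃ ε : ℝ, 0 < ε ∧ ∃ n₀ : ℕ, ∀ n ≥ n₀, (n : ℝ) ^ (2 + ε) ≤ (Literature.Computability.AlgebraicComplexity.determinantalComplexity (Literature.Computability.AlgebraicComplexity.perPoly (Fin n) ℂ) : ℝ)

-- earlier NormalFormOfSubs (stmt-ValiantsHypothesis-17582, replaced 2026-08-17T02:13:51Z -> stmt-ValiantsHypothesis-17832): retired by None — Summit.ValiantsHypothesis.ValiantsHypothesis.Theses.ScaledPencil.PencilOfAffine → Summit.ValiantsHypothesis.ValiantsHypothesis.Theses.ScaledPencil.ScaledSameSize → Summit.ValiantsHypothesis.ValiantsHypothesis.Theses.ScaledPencil.MinimalRepStable → Summit.Valia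
/-- item stmt-ValiantsHypothesis-17832 · support · rank 9 · closed · proved by Summit.ValiantsHypothesis.ValiantsHypothesis.Theorems.ScaledPencilNormalFormSplit.normalFormOfSubs_proof (prover) · by planner
[support] glue of the typed split of the crux NormalForm (strategist
cstrat-stmt-ValiantsHypothesis-5317-r1, BC2 redirect): PencilOfAffine → ScaledSameSize →
MinimalRepStable → NormalForm, with the three antecedents written out verbatim (the bodies of the
route items PencilOfAffine = stmt-5322, ScaledSameSize = stmt-5320, MinimalRepStable = stmt-5321,
all PROVED) because the gate renders rank-9 supports in id order and this item precedes them in the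
file; definitionally equal to the arrow over the named decls (checked: `theorem _ : NormalFormOfSubs
:= normalForm_of_subs` is pure defeq, rc 0). Proof: descend to the minimal size m₀ = Nat.find (∃ k,
HasDetRepr per_n k) ≤ m, pencil form, same-size rescaling inside the fibre {det = per_n},
θ-stability from minimality — PROVED sorry-free (17 lines) as `normalForm_of_subs` in the candidate
proof ScaledPencilNormalFormSplit.lean (attached) and as `NormalForm_of` in
Cruxes/NormalForm/Lines/support_split.lean; together with the three proved pieces it closes
NormalForm (`normalForm_proof`). [difficulty: provable-now] [KempfNess1979, King1994] -/
@[route_item "route-ValiantsHypothesis-ScaledPencil"]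
def NormalFormOfSubs : Prop :=
  (∀ (n m : ℕ), Literature.Computability.AlgebraicComplexity.HasDetRepr (Literature.Computability.AlgebraicComplexity.perPoly (Fin n) ℂ) m ↔ ∃ (Λ : Matrix (Fin m) (Fin m) ℂ) (L : Fin n × Fin n → Matrix (Fin m) (Fin m) ℂ), (Matrix.of fun a b => MvPolynomial.C (Λ a b) + ∑ v : Fin n × Fin n, MvPolynomial.C (L v a b) * MvPolynomial.X v).det = Literature.Computability.AlgebraicComplexity.perPoly (Fin n) ℂ) → (∀ (n m : ℕ) (Λ : Matrix (Fin m) (Fin m) ℂ) (L : Fin n × Fin n → Matrix (Fin m) (Fin m) ℂ), (Matrix.of fun a b => MvPolynomial.C (Λ a b) + ∑ v : Fin n × Fin n, MvPolynomial.C (L v a b) * MvPolynomial.X v).det = Literature.Computability.AlgebraicComplexity.perPoly (Fin n) ℂ → ∃ (Λ' : Matrix (Fin m) (Fin m) ℂ) (L' : Fin n × Fin n → Matrix (Fin m) (Fin m) ℂ), (Matrix.of fun a b => MvPolynomial.C (Λ' a b) + ∑ v : Fin n × Fin n, MvPolynomial.C (L' v a b) * MvPolynomial.X v).det = Literature.Computability.AlgebraicComplexity.perPoly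 (Fin n) ℂ ∧ (∃ α : ℝ, 0 < α ∧ Λ' * Λ'.conjTranspose + ∑ v, L' v * (L' v).conjTranspose = (α : ℂ) • (1 : Matrix (Fin m) (Fin m) ℂ) ∧ Λ'.conjTranspose * Λ' + ∑ v, (L' v).conjTranspose * L' v = (α : ℂ) • (1 : Matrix (Fin m) (Fin m) ℂ) ∧ (∀ i : Fin n, ∑ j : Fin n, ∑ a, ∑ b, ‖L' (i, j) a b‖ ^ 2 = α) ∧ (∀ j : Fin n, ∑ i : Fin n, ∑ a, ∑ b, ‖L' (i, j) a b‖ ^ 2 = α))) → (∀ (n m : ℕ), (∀ m' < m, ¬ Literature.Computability.AlgebraicComplexity.HasDetRepr (Literature.Computability.AlgebraicComplexity.perPoly (Fin n) ℂ) m') → ∀ (Λ : Matrix (Fin m) (Fin m) ℂ) (L : Fin n × Fin n → Matrix (Fin m) (Fin m) ℂ), (Matrix.of fun a b => MvPolynomial.C (Λ a b) + ∑ v : Fin n × Fin n, MvPolynomial.C (L v a b) * MvPolynomial.X v).det = Literature.Computability.AlgebraicComplexity.perPoly (Fin n) ℂ → ∀ U : Submodule ℂ (Fin m → ℂ), U ≠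 ⊥ → U ≠ ⊤ → Module.finrank ℂ U < Module.finrank ℂ ↥(U.map (Matrix.toLin' Λ) ⊔ ⨆ v, U.map (Matrix.toLin' (L v)))) → NormalForm

-- `NormalFormOfSubs` holds: proved by `Summit.ValiantsHypothesis.ValiantsHypothesis.Theorems.ScaledPencilNormalFormSplit.normalFormOfSubs_proof` (its module imports this route file, so no `_holds` link can be stated here).

/-- item stmt-ValiantsHypothesis-5320 · support · rank 9 · closed · proved by Summit.ValiantsHypothesis.Theorems.scaledSameSize_proof (prover) · by planner
sources: KempfNess1979, GargEtAl2019, Gurvits2004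
[support] analytic half of NormalForm, same size: if (Λ, L) of size m computes per_n then some (Λ',
L') of the SAME size m computes per_n and is scaled + balanced with one α > 0 (minimise ‖Λ‖² +
Σ‖L_ij‖² over the closure of the 𝒢-orbit, which lies in the closed fibre; differentiate along
Hermitian one-parameter subgroups; the single character forces equal constants). [difficulty:
provable-now] -/
@[route_item "route-ValiantsHypothesis-ScaledPencil"]
def ScaledSameSize : Prop :=
  ∀ (n m : ℕ) (Λ : Matrix (Fin m) (Fin m) ℂ) (L : Fin n × Fin n → Matrix (Fin m) (Fin m) ℂ), (Matrix.of fun a b => MvPolynomial.C (Λ a b) + ∑ v : Fin n × Fin n, MvPolynomial.C (L v a b) * MvPolynomial.X v).det = Literature.Computability.AlgebraicComplexity.perPoly (Fin n) ℂ → ∃ (Λ' : Matrix (Fin m) (Fin m) ℂ) (L' : Fin n × Fin n → Matrix (Fin m) (Fin m) ℂ), (Matrix.of fun a b => MvPolynomial.C (Λ' a b) + ∑ v : Fin n × Fin n, MvPolynomial.C (L' v a b) * MvPolynomial.X v).det = Literature.Computability.AlgebraicComplexity.perPoly (Fin n) ℂ ∧ (∃ α : ℝ, 0 < α ∧ Λ'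 * Λ'.conjTranspose + ∑ v, L' v * (L' v).conjTranspose = (α : ℂ) • (1 : Matrix (Fin m) (Fin m) ℂ) ∧ Λ'.conjTranspose * Λ' + ∑ v, (L' v).conjTranspose * L' v = (α : ℂ) • (1 : Matrix (Fin m) (Fin m) ℂ) ∧ (∀ i : Fin n, ∑ j : Fin n, ∑ a, ∑ b, ‖L' (i, j) a b‖ ^ 2 = α) ∧ (∀ j : Fin n, ∑ i : Fin n, ∑ a, ∑ b, ‖L' (i, j) a b‖ ^ 2 = α))

-- `ScaledSameSize` holds: proved by `Summit.ValiantsHypothesis.Theorems.scaledSameSize_proof` (its module imports this route file, so no `_holds` link can be stated here).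

/-- item stmt-ValiantsHypothesis-5321 · support · rank 9 · closed · proved by Summit.ValiantsHypothesis.ValiantsHypothesis.Theorems.minimalRepStable_proof @ 0865e2a5bbee (prover) · by planner
sources: King1994, vonzurGathen1987, MathesOmladicRadjavi1991
[support] algebraic half of NormalForm: if per_n has no affine determinantal representation of size
< m, then EVERY pencil (Λ, L) of size m computing per_n is θ-stable (a subrepresentation (U, W) with
dim U = dim W block-triangularises the pencil, det = det(block₁)·det(block₂), and irreducibility of
per_n makes one block a constant, giving a smaller representation; dim W < dim U would make det ≡
0). [difficulty: provable-now] -/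
@[route_item "route-ValiantsHypothesis-ScaledPencil"]
def MinimalRepStable : Prop :=
  ∀ (n m : ℕ), (∀ m' < m, ¬ Literature.Computability.AlgebraicComplexity.HasDetRepr (Literature.Computability.AlgebraicComplexity.perPoly (Fin n) ℂ) m') → ∀ (Λ : Matrix (Fin m) (Fin m) ℂ) (L : Fin n × Fin n → Matrix (Fin m) (Fin m) ℂ), (Matrix.of fun a b => MvPolynomial.C (Λ a b) + ∑ v : Fin n × Fin n, MvPolynomial.C (L v a b) * MvPolynomial.X v).det = Literature.Computability.AlgebraicComplexity.perPoly (Fin n) ℂ → ∀ U : Submodule ℂ (Fin m → ℂ), U ≠ ⊥ → U ≠ ⊤ → Module.finrank ℂ U < Module.finrank ℂ ↥(U.map (Matrix.toLin' Λ) ⊔ ⨆ v, U.map (Matrix.toLin' (L v)))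

-- `MinimalRepStable` holds: proved by `Summit.ValiantsHypothesis.ValiantsHypothesis.Theorems.minimalRepStable_proof` @ 0865e2a5bbee (its module imports this route file, so no `_holds` link can be stated here).

/-- item stmt-ValiantsHypothesis-5322 · support · rank 9 · closed · proved by Summit.ValiantsHypothesis.ValiantsHypothesis.Theorems.pencilOfAffine_proof @ a483d0e85ab7 (prover) · by planner
sources: MignonRessayre2004, Burgisser2000
[support] bookkeeping between `HasDetRepr` (matrices of affine polynomials) and pencil data: per_n
has an affine determinantal representation of size m iff some (Λ, L) of size m has det(Λ + Σ x_ij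
L_ij) = per_n (an entry of total degree ≤ 1 is its constant coefficient plus Σ_v coeff_v · x_v).
[difficulty: provable-now] -/
@[route_item "route-ValiantsHypothesis-ScaledPencil"]
def PencilOfAffine : Prop :=
  ∀ (n m : ℕ), Literature.Computability.AlgebraicComplexity.HasDetRepr (Literature.Computability.AlgebraicComplexity.perPoly (Fin n) ℂ) m ↔ ∃ (Λ : Matrix (Fin m) (Fin m) ℂ) (L : Fin n × Fin n → Matrix (Fin m) (Fin m) ℂ), (Matrix.of fun a b => MvPolynomial.C (Λ a b) + ∑ v : Fin n × Fin n, MvPolynomial.C (L v a b) * MvPolynomial.X v).det = Literature.Computability.AlgebraicComplexity.perPoly (Fin n) ℂ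

-- `PencilOfAffine` holds: proved by `Summit.ValiantsHypothesis.ValiantsHypothesis.Theorems.pencilOfAffine_proof` @ a483d0e85ab7 (its module imports this route file, so no `_holds` link can be stated here).

/-- item stmt-ValiantsHypothesis-5323 · support · rank 9 · closed · proved by Summit.ValiantsHypothesis.ScaledPencil.nfToDc_proof @ 8fd72a57f796 (prover) · by planner
sources: Burgisser2000, MignonRessayre2004
[support] glue: NormalForm and ScaledPencilNoQP give DcPerNotQP (if dc(per_n) ≤ 2^((log₂ n + c)^c)
then, dc being attained (`hasDetRepr_determinantalComplexity_holds`), NormalForm yields a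
normal-form pencil of size ≤ that bound, contradicting X at c). [difficulty: provable-now] -/
@[route_item "route-ValiantsHypothesis-ScaledPencil"]
def NfToDc : Prop :=
  NormalForm → ScaledPencilNoQP → DcPerNotQP

-- `NfToDc` holds: proved by `Summit.ValiantsHypothesis.ScaledPencil.nfToDc_proof` @ 8fd72a57f796 (its module imports this route file, so no `_holds` link can be stated here).

/-- item stmt-ValiantsHypothesis-5324 · assembly · rank 1 · closed · proved by Summit.ValiantsHypothesis.ScaledPencil.assembly_proof @ 67f4302eac41 (prover) · by planner
sources: BurgisserClausenShokrollahi1997, Valiant1979, Burgisser2000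
[assembly] NormalForm → ScaledPencilNoQP → ValiantsHypothesis. -/
@[route_item "route-ValiantsHypothesis-ScaledPencil", crux]
def Assembly : Prop :=
  NormalForm → ScaledPencilNoQP → ValiantsHypothesis

-- `Assembly` holds: proved by `Summit.ValiantsHypothesis.ScaledPencil.assembly_proof` @ 67f4302eac41 (its module imports this route file, so no `_holds` link can be stated here).

/-! D-0027 §2.1 — DECIDING THEOREM (planner-authored via `route open/edit --closes-file`; by planner-rrepair-ValiantsHypothesis-ScaledPenci-dcd6adba-g2-0 2026-08-15T17:00:51Z):
its hypotheses are this route's items and its conclusion the sub-problem Statement (glue_lint), and it elaborates with this file. -/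

@[closes "route-ValiantsHypothesis-ScaledPencil"] theorem closes (hNormalForm : NormalForm) (hX : ScaledPencilNoQP) (hAssembly : Assembly) :
    _root_.ValiantsHypothesis :=
  hAssembly hNormalForm hX

end Summit.ValiantsHypothesis.ValiantsHypothesis.Theses.ScaledPencil
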